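import Mathlib
import Summits.AtomisticToContinuum.Crystallization.Theses.PhononSlackCertificates
import Summits.AtomisticToContinuum.Crystallization.Theorems.PhononSlackCertificatesNearFieldConvexityStubPnfOfLocalCertificate8
import Summits.AtomisticToContinuum.Crystallization.Theorems.PhononSlackCertificatesNearFieldConvexityStubFluxEnvelope
import Summits.AtomisticToContinuum.Crystallization.Theorems.PhononSlackCertificatesNearFieldConvexityStubSelfSiteFloor
import Summits.AtomisticToContinuum.Crystallization.Theorems.PhononSlackCertificatesNearFieldConvexityStubPairCountOfCrossing

/-!
# Crux `PhononSlackCertificates.NearFieldConvexity` (stmt-AtomisticToContinuum-13958), line `Sketch`: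
piece `stub_flatnessOfCertificate` of stub `stub_flatnessPaid` (I_flat) — (I_flat) from a POINTWISE FLATNESS CERTIFICATE

The perturbative half (I_flat) of the split energy stub asks, on a set `Ω` of `ε₁`-good particles of a `δ`-separated
configuration (`ε₁ ∈ [1/100, 1/20]`), for affine-flatness witnesses `(sW, Gw, νw)` and `rw`-close box cells
`(Aw, aw, hw)` at the radius-8 interior sites, whose total defect `Σ_{i ∈ int₈Ω} (2400 νw_i² + 800 rw_i²)` is paid
linearly by `K·[E_self(Ω) − |Ω|·e*] + C·#∂₄Ω`.  This file derives it from the SITEWISE format an analytic proof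
(landscape coercivity + first-order flux written as transfers) produces: the same witnesses together with an
antisymmetric transfer `τ`, `|τ i j| ≤ M·|x i − x j|⁻⁶`, such that at every radius-8 interior site the local defect
`w_i := 2400 νw_i² + 800 rw_i²` is paid by `K` times the SITE excess `e_i − e*` (`e_i = ½Σ_{j∈Ω∖i} V_LJ`) plus the net
transfer `Σ_{j∈Ω} τ i j`.

Proof = the bookkeeping of the landed `stub_roughOfCertificate` / `stub_pnfOfLocalCertificate8` with the indicator
weight replaced by the real weight `w_i ≥ 0` (`fc_bookkeeping`: summed over the radius-8 interior `I₈`, internal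
transfers cancel by antisymmetry); the flux into the collar `B₈ = Ω ∖ I₈` is `≤ 250|M|δ⁻⁶·#B₈` (`stub_fluxEnvelope`), the
collar's site excesses are `≥ −(250/12)δ⁻⁶` (`stub_selfSiteFloor`), and `#B₈ ≤ (1 + |C_pc|(17/4)⁴)·#∂₄Ω`
(`collar8_card_le`, `stub_pairCountOfCrossing`, goodness being monotone in the tolerance, `IsTwoShellGood.mono`).
Constants: `K' := K`, `C' := (K(250/12)δ⁻⁶ + 250|M|δ⁻⁶)(1 + |C_pc|(17/4)⁴)`.  All `[folklore]`.
-/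

noncomputable section

open scoped BigOperators
open Literature.MathematicalPhysics.StatisticalMechanics Literature.Geometry.DiscreteGeometry

namespace Summit.AtomisticToContinuum.Crystallization.Theorems.PhononSlackNearFieldConvexity

/-- **Weighted bookkeeping for a pointwise certificate.**  On a finite index type: a region `Ω`, its interior
`I ⊆ Ω`, the collar `B = Ω ∖ I`; an antisymmetric transfer `τ`, site excesses `E`, nonnegative rate `K` and weights
`w` with the pointwise bound `w i ≤ K·E i + Σ_{j∈Ω} τ i j` on `I`, a bound `Φ` on the flux `Σ_{i∈I} Σ_{j∈B} τ i j`
into the collar, and the floor `−L ≤ E` on the collar; then `Σ_I w ≤ K·Σ_Ω E + K·L·#B + Φ` (internal transfers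
cancel by antisymmetry). [folklore] -/
theorem fc_bookkeeping {ι : Type*} [DecidableEq ι] (w E : ι → ℝ) (τ : ι → ι → ℝ) (Ω I B : Finset ι)
    {K Φ L : ℝ} (hK : 0 ≤ K)
    (hτ : ∀ i j, τ i j = -τ j i) (hI : I ⊆ Ω) (hB : ∀ i, i ∈ B ↔ i ∈ Ω ∧ i ∉ I)
    (hpt : ∀ i ∈ I, w i ≤ K * E i + ∑ j ∈ Ω, τ i j)
    (hflux : ∑ i ∈ I, ∑ j ∈ B, τ i j ≤ Φ)
    (hbdry : ∀ i ∈ B, -L ≤ E i) :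
    ∑ i ∈ I, w i ≤ K * ∑ i ∈ Ω, E i + K * L * (B.card : ℝ) + Φ := by
  -- split the region into interior and collar
  have hΩsplit : ∀ f : ι → ℝ, ∑ i ∈ Ω, f i = ∑ i ∈ I, f i + ∑ i ∈ B, f i := by
    intro f
    rw [← Finset.sum_filter_add_sum_filter_not Ω (fun i => i ∈ I)]
    congr 1
    · congr 1
      ext i
      simp only [Finset.mem_filter]
      exact ⟨fun h => h.2, fun h => ⟨hI h, h⟩⟩
    · congr 1
      ext i
      rw [Finset.mem_filter, hB]
  -- interior: the pointwise bound, summed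
  have hint : ∑ i ∈ I, w i ≤ ∑ i ∈ I, (K * E i + ∑ j ∈ Ω, τ i j) :=
    Finset.sum_le_sum fun i hi => hpt i hi
  -- internal transfers cancel
  have hanti : ∑ i ∈ I, ∑ j ∈ I, τ i j = 0 := by
    have h := Finset.sum_comm (s := I) (t := I) (f := τ)
    have h2 : ∑ j ∈ I, ∑ i ∈ I, τ i j = -∑ j ∈ I, ∑ i ∈ I, τ j i := by
      rw [← Finset.sum_neg_distrib]
      refine Finset.sum_congr rfl fun j _ => ?_
      rw [← Finset.sum_neg_distrib]
      exact Finset.sum_congr rfl fun i _ => hτ i j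
    linarith
  -- the transfer sum over `Ω` splits into the internal part and the flux into the collar
  have hτsplit : ∑ i ∈ I, ∑ j ∈ Ω, τ i j = ∑ i ∈ I, ∑ j ∈ I, τ i j + ∑ i ∈ I, ∑ j ∈ B, τ i j := by
    rw [← Finset.sum_add_distrib]
    exact Finset.sum_congr rfl fun i _ => hΩsplit (τ i)
  have hIsum : ∑ i ∈ I, w i ≤ K * ∑ i ∈ I, E i + Φ := by
    have h1 : ∑ i ∈ I, (K * E i + ∑ j ∈ Ω, τ i j) = K * ∑ i ∈ I, E i + ∑ i ∈ I, ∑ j ∈ Ω, τ i j := by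
      rw [Finset.sum_add_distrib, Finset.mul_sum]
    rw [h1, hτsplit, hanti, zero_add] at hint
    linarith
  -- collar: the floor
  have hBsum : -L * (B.card : ℝ) ≤ ∑ i ∈ B, E i := by
    have h : ∑ _i ∈ B, (-L) ≤ ∑ i ∈ B, E i := Finset.sum_le_sum fun i hi => hbdry i hi
    rwa [Finset.sum_const, nsmul_eq_mul, mul_comm] at h
  have hKB := mul_le_mul_of_nonneg_left hBsum hK
  rw [hΩsplit E]
  linarith [hIsum, hKB]

/-- **Registered headline `stub_flatnessOfCertificate` (piece of `stub_flatnessPaid`, worker W5): (I_flat) from a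
pointwise flatness certificate with `r⁻⁶` transfers.**  See the module docstring for the format of the certificate
and the constants. [folklore] -/
theorem stub_flatnessOfCertificate : (∃ ε₁ : ℝ, 1 / 100 ≤ ε₁ ∧ ε₁ ≤ 1 / 20 ∧ ∀ δ : ℝ, 0 < δ → ∃ K : ℝ, 0 ≤ K ∧ ∃ M : ℝ, ∀ (N : ℕ) (x : Fin N → EuclideanSpace ℝ (Fin 3)), (∀ i j : Fin N, i ≠ j → δ ≤ dist (x i) (x j)) → ∀ Ω : Finset (Fin N), (∀ i ∈ Ω, IsTwoShellGood ε₁ (47 / 50) 1 x i) → ∃ (sW : Fin N → ℤ → ℤ) (Gw : Fin N → (EuclideanSpace ℝ (Fin 3) →L[ℝ] EuclideanSpace ℝ (Fin 3))) (νw rw : Fin N → ℝ) (Aw : Fin N → (EuclideanSpace ℝ (Fin 3) →ₗᵢ[ℝ] EuclideanSpace ℝ (Fin 3))) (aw hw : Fin N → ℝ) (τ : Fin N → Fin N → ℝ), (∀ i j, τ i j = -τ j i) ∧ (∀ i j, |τ i j| ≤ M * (dist (x i) (x j))⁻¹ ^ 6) ∧ ∀ i ∈ Ω, (∀ k : Fin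 N, dist (x k) (x i) ≤ 8 → k ∈ Ω) → (IsHaggSeq (sW i) ∧ 0 ≤ νw i ∧ ((∀ j : Fin N, dist (x j) (x i) ≤ 3 → ∃ m u v : ℤ, dist (x j - x i) ((Gw i) (barlowPos 1 (Real.sqrt 6 / 3) (sW i) m u v)) ≤ (νw i)) ∧ (∀ m u v : ℤ, ‖(Gw i) (barlowPos 1 (Real.sqrt 6 / 3) (sW i) m u v)‖ ≤ 3 → ∃ j : Fin N, dist (x j - x i) ((Gw i) (barlowPos 1 (Real.sqrt 6 / 3) (sW i) m u v)) ≤ (νw i)) ∧ (∀ p : EuclideanSpace ℝ (Fin 3), 4 / 5 * ‖p‖ ≤ ‖(Gw i) p‖ ∧ ‖(Gw i) p‖ ≤ 6 / 5 * ‖p‖)) ∧ 47 / 50 ≤ aw i ∧ aw i ≤ 1 ∧ 39 / 50 * aw i ≤ hw i ∧ hw i ≤ 17 / 20 * aw i ∧ (∀ m u v : ℤ, ‖barlowPos 1 (Real.sqrt 6 / 3) (sW i) m u v‖ ≤ 3 → dist ((Gw i) (barlowPos 1 (Real.sqrt 6 / 3) (sW i) m u v)) ((Aw i) (barlowPos (aw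 i) (hw i) (sW i) m u v)) < rw i)) ∧ 2400 * (νw i) ^ 2 + 800 * (rw i) ^ 2 ≤ K * ((1 / 2 : ℝ) * (∑ j ∈ Ω.erase i, lennardJones (dist (x i) (x j))) - (⨅ Q : PeriodicConfiguration 3, Q.energyPerParticle lennardJones)) + ∑ j ∈ Ω, τ i j) → ∃ ε₁ : ℝ, 1 / 100 ≤ ε₁ ∧ ε₁ ≤ 1 / 20 ∧ ∀ δ : ℝ, 0 < δ → ∃ K : ℝ, 0 ≤ K ∧ ∃ C : ℝ, ∀ (N : ℕ) (x : Fin N → EuclideanSpace ℝ (Fin 3)), (∀ i j : Fin N, i ≠ j → δ ≤ dist (x i) (x j)) → ∀ Ω : Finset (Fin N), (∀ i ∈ Ω, IsTwoShellGood ε₁ (47 / 50) 1 x i) → ∃ (sW : Fin N → ℤ → ℤ) (Gw : Fin N → (EuclideanSpace ℝ (Fin 3) →L[ℝ] EuclideanSpace ℝ (Fin 3))) (νw rw : Fin N → ℝ) (Aw : Fin N → (EuclideanSpace ℝ (Fin 3) →ₗᵢ[ℝ] EuclideanSpace ℝ (Fin 3))) (aw hw : Fin N → ℝ), (∀ i ∈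 Ω, (∀ k : Fin N, dist (x k) (x i) ≤ 8 → k ∈ Ω) → IsHaggSeq (sW i) ∧ 0 ≤ νw i ∧ ((∀ j : Fin N, dist (x j) (x i) ≤ 3 → ∃ m u v : ℤ, dist (x j - x i) ((Gw i) (barlowPos 1 (Real.sqrt 6 / 3) (sW i) m u v)) ≤ (νw i)) ∧ (∀ m u v : ℤ, ‖(Gw i) (barlowPos 1 (Real.sqrt 6 / 3) (sW i) m u v)‖ ≤ 3 → ∃ j : Fin N, dist (x j - x i) ((Gw i) (barlowPos 1 (Real.sqrt 6 / 3) (sW i) m u v)) ≤ (νw i)) ∧ (∀ p : EuclideanSpace ℝ (Fin 3), 4 / 5 * ‖p‖ ≤ ‖(Gw i) p‖ ∧ ‖(Gw i) p‖ ≤ 6 / 5 * ‖p‖)) ∧ 47 / 50 ≤ aw i ∧ aw i ≤ 1 ∧ 39 / 50 * aw i ≤ hw i ∧ hw i ≤ 17 / 20 * aw i ∧ (∀ m u v : ℤ, ‖barlowPos 1 (Real.sqrt 6 / 3) (sW i) m u v‖ ≤ 3 → dist ((Gw i) (barlowPos 1 (Real.sqrt 6 / 3) (sW i) m u v)) ((Aw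 i) (barlowPos (aw i) (hw i) (sW i) m u v)) < rw i)) ∧ (∑ i ∈ Ω.filter (fun i => ∀ k : Fin N, dist (x k) (x i) ≤ 8 → k ∈ Ω), (2400 * (νw i) ^ 2 + 800 * (rw i) ^ 2)) ≤ K * ((∑ i ∈ Ω, (1 / 2 : ℝ) * (∑ j ∈ Ω.erase i, lennardJones (dist (x i) (x j)))) - (Ω.card : ℝ) * (⨅ Q : PeriodicConfiguration 3, Q.energyPerParticle lennardJones)) + C * (Nat.card {i : Fin N // i ∈ Ω ∧ ∃ j : Fin N, j ∉ Ω ∧ dist (x j) (x i) ≤ 4} : ℝ) := by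
  rintro ⟨ε₁, hε₁, hε₁', hcert⟩
  refine ⟨ε₁, hε₁, hε₁', fun δ hδ => ?_⟩
  obtain ⟨K, hK, M, hM⟩ := hcert δ hδ
  obtain ⟨Cp, hCp⟩ := stub_pairCountOfCrossing δ hδ
  obtain ⟨Kc, hKcdef⟩ : ∃ Kc : ℝ, Kc = 1 + |Cp| * (17 / 4 : ℝ) ^ 4 := ⟨_, rfl⟩
  obtain ⟨L, hLdef⟩ : ∃ L : ℝ, L = K * (250 / 12 * δ⁻¹ ^ 6) + 250 * |M| * δ⁻¹ ^ 6 := ⟨_, rfl⟩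
  refine ⟨K, hK, L * Kc, ?_⟩
  intro N x hsep Ω hΩ
  obtain ⟨sW, Gw, νw, rw, Aw, aw, hw, τ, hτ, hτM, hpt⟩ := hM N x hsep Ω hΩ
  refine ⟨sW, Gw, νw, rw, Aw, aw, hw, fun i hi hint => (hpt i hi hint).1, ?_⟩
  -- radius-8 interior and collar of `Ω`
  set I : Finset (Fin N) := Ω.filter (fun i => ∀ k : Fin N, dist (x k) (x i) ≤ 8 → k ∈ Ω) with hIdef
  set B : Finset (Fin N) := Ω.filter (fun i => ∃ j : Fin N, j ∉ Ω ∧ dist (x j) (x i) ≤ 8) with hBdef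
  rw [lc_natCard_eq]
  have hIΩ : I ⊆ Ω := Finset.filter_subset _ _
  have hBmem : ∀ i, i ∈ B ↔ i ∈ Ω ∧ i ∉ I := by
    intro i
    simp only [hBdef, hIdef, Finset.mem_filter]
    constructor
    · rintro ⟨hi, j, hj, hd⟩
      exact ⟨hi, fun h' => hj (h'.2 j hd)⟩
    · rintro ⟨hi, h'⟩
      refine ⟨hi, ?_⟩
      by_contra hne
      exact h' ⟨hi, fun j hd => by_contra fun hj => hne ⟨j, hj, hd⟩⟩
  have hdisj : Disjoint I B := by
    rw [Finset.disjoint_left]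
    intro i hiI hiB
    exact ((hBmem i).1 hiB).2 hiI
  -- the flux into the collar, by the envelope
  have hfluxIB : ∑ i ∈ I, ∑ j ∈ B, τ i j ≤ 250 * |M| * δ⁻¹ ^ 6 * (B.card : ℝ) := by
    have h1 : ∑ i ∈ I, ∑ j ∈ B, τ i j ≤ ∑ i ∈ I, ∑ j ∈ B, |M| * (dist (x i) (x j))⁻¹ ^ 6 := by
      refine Finset.sum_le_sum fun i _ => Finset.sum_le_sum fun j _ => ?_
      have hb := hτM i j
      have h0 : (0 : ℝ) ≤ (dist (x i) (x j))⁻¹ ^ 6 := by positivity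
      calc τ i j ≤ |τ i j| := le_abs_self _
        _ ≤ M * (dist (x i) (x j))⁻¹ ^ 6 := hb
        _ ≤ |M| * (dist (x i) (x j))⁻¹ ^ 6 := mul_le_mul_of_nonneg_right (le_abs_self M) h0
    have h2 : ∑ i ∈ I, ∑ j ∈ B, |M| * (dist (x i) (x j))⁻¹ ^ 6 =
        |M| * ∑ i ∈ I, ∑ j ∈ B, (dist (x i) (x j))⁻¹ ^ 6 := by
      rw [Finset.mul_sum]
      refine Finset.sum_congr rfl fun i _ => ?_
      rw [Finset.mul_sum]
    have h3 := stub_fluxEnvelope N x δ hδ hsep I B hdisj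
    have hM0 : 0 ≤ |M| := abs_nonneg M
    rw [h2] at h1
    nlinarith [h1, h3, hM0]
  -- the weighted bookkeeping (radius-8 interior), weight `2400 νw² + 800 rw²`
  have key := fc_bookkeeping
    (fun i : Fin N => 2400 * (νw i) ^ 2 + 800 * (rw i) ^ 2)
    (fun i : Fin N => (1 / 2 : ℝ) * (∑ j ∈ Ω.erase i, lennardJones (dist (x i) (x j))) - (⨅ Q : PeriodicConfiguration 3, Q.energyPerParticle lennardJones))
    τ Ω I B hK hτ hIΩ hBmem
    (fun i hi => (hpt i (hIΩ hi) (Finset.mem_filter.1 hi).2).2)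
    hfluxIB
    (fun i _ => stub_selfSiteFloor N x δ hδ hsep Ω i)
  beta_reduce at key
  -- the collar count: `#B ≤ Kc · #∂₄Ω` (goodness is monotone in the tolerance: `Ω` is `1/20`-good)
  have hΩ' : ∀ i ∈ Ω, IsTwoShellGood (1 / 20) (47 / 50) 1 x i :=
    fun i hi => (hΩ i hi).mono hε₁' (by norm_num)
  have hcol := collar8_card_le x Ω
  have hpair := hCp N x hsep Ω hΩ' (17 / 4) (by norm_num)
  rw [lc_natCard_eq] at hpair
  set B4c : ℝ := ((Ω.filter fun i => ∃ j : Fin N, j ∉ Ω ∧ dist (x j) (x i) ≤ 4).card : ℝ) with hB4c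
  have hB40 : 0 ≤ B4c := Nat.cast_nonneg _
  have hBle : (B.card : ℝ) ≤ Kc * B4c := by
    have h1 : (B.card : ℝ) ≤ B4c + Cp * (17 / 4 : ℝ) ^ 4 * B4c := by
      have := hcol
      rw [← hBdef] at this
      linarith
    have h2 : Cp * (17 / 4 : ℝ) ^ 4 * B4c ≤ |Cp| * (17 / 4 : ℝ) ^ 4 * B4c :=
      mul_le_mul_of_nonneg_right (mul_le_mul_of_nonneg_right (le_abs_self Cp) (by positivity)) hB40
    rw [hKcdef]
    nlinarith
  have hRHS : (∑ i ∈ Ω, (1 / 2 : ℝ) * (∑ j ∈ Ω.erase i, lennardJones (dist (x i) (x j)))) -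
      (Ω.card : ℝ) * (⨅ Q : PeriodicConfiguration 3, Q.energyPerParticle lennardJones) =
      ∑ i ∈ Ω, ((1 / 2 : ℝ) * (∑ j ∈ Ω.erase i, lennardJones (dist (x i) (x j))) - (⨅ Q : PeriodicConfiguration 3, Q.energyPerParticle lennardJones)) := by
    rw [Finset.sum_sub_distrib, Finset.sum_const, nsmul_eq_mul]
  rw [hRHS]
  have hB0 : (0 : ℝ) ≤ (B.card : ℝ) := Nat.cast_nonneg _
  have hL0 : 0 ≤ L := by rw [hLdef]; positivity
  have hstep : L * (B.card : ℝ) ≤ L * (Kc * B4c) := mul_le_mul_of_nonneg_left hBle hL0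
  have hLB : L * (B.card : ℝ) = K * (250 / 12 * δ⁻¹ ^ 6) * (B.card : ℝ) + 250 * |M| * δ⁻¹ ^ 6 * (B.card : ℝ) := by
    rw [hLdef]; ring
  linarith [key, hstep, hLB]

end Summit.AtomisticToContinuum.Crystallization.Theorems.PhononSlackNearFieldConvexity
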